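import Literature.AlgebraicGeometry.Resolution.ApproximationDegree
import HarnessLib

/-!
# Approximation coefficients in relative approximation degree one (Kuhlmann–Vlahu 2014, §12)

Topic: `Literature/AlgebraicGeometry/Resolution` (valued function fields). Continuation of
`ApproximationDegree.lean`: F.-V. Kuhlmann, I. Vlahu, *The relative approximation degree in
valued function fields*, Math. Z. 276 (2014) = arXiv:1304.0200, §12 "Approximation
coefficients", in the case of relative approximation degree `𝐡 = 1` — the case needed by the
pull down principle (§14: Lemma 14.4, Thm. 14.5 = Kuhlmann 2019, Thm. 1.3, the algebraic
counterpart of the descent step of Temkin 2013, Thm. 3.2.3):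

> An element `d ∈ K` will be called an approximation coefficient of `y` in `x` … if
> `v(f(x) − f(c)) < v(f(x) − f(c) − d · (x − c)^𝐡)` for `c ↗ x`.
> **Lemma 12.2.** The element `d ∈ K` is an approximation coefficient of `y` in `x` if and only
> if `vd = v f_𝐡(c) < v(f_𝐡(c) − d)` for `c ↗ x`. In particular, there exists an approximation
> coefficient.
> **Lemma 12.3.** Take elements `yᵢ` … with common approximation degree `𝐡 = 𝐡_K(x:yᵢ)` …
> approximation coefficients `dᵢ` … and `kᵢ ∈ K` such that `v ∑ kᵢ dᵢ = minᵢ v kᵢ dᵢ < ∞`. Then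
> `𝐡_K(x : ∑ kᵢ yᵢ) = 𝐡`.

## Content (everything PROVED; no definitions, no named facts)

* `valuation_sub_eval_lt_of_good` — a good approximant `f(x)` of `y` ("`v(y − f(x)) ≥ dist(y,K)`")
  is strictly closer to `y` than the Taylor scale `|f(x) − f(c)|`, and `|y − f(c)| = |f(x) − f(c)|`
  [cite: KuhlmannVlahu2014, Lemma 8.1].
* `exists_mem_valuation_sub_lt_self` — closer elements of `K` for elements of an immediate `K(x)`.
* `exists_approximationCoefficient` — **Lemma 12.2 (`𝐡 = 1`)** [cite: KuhlmannVlahu2014, Lemma 12.2].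
* `approximationDegree_one_sum` — **Lemma 12.3 (`𝐡 = 1`), polynomial part**: a linear
  combination `∑ kᵢ fᵢ` without cancellation of the approximation coefficients has relative
  approximation degree `1` with constant `|∑ kᵢ dᵢ|` [cite: KuhlmannVlahu2014, Lemma 12.3].

## Sources

* F.-V. Kuhlmann, I. Vlahu, Math. Z. 276 (2014) = arXiv:1304.0200: §12, Lemmas 12.1–12.3
  (p. 23); Lemma 8.1. [KuhlmannVlahu2014]

## Rendering notes

As in `ApproximationDegree.lean`. "`v ∑ kᵢ dᵢ = minᵢ v kᵢ dᵢ`" is rendered multiplicatively as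
`|kᵢ dᵢ| ≤ |∑ kᵢ dᵢ|` for all `i` together with `∑ kᵢ dᵢ ≠ 0`.
-/

noncomputable section

open Polynomial Finset

namespace Literature.AlgebraicGeometry.Resolution

universe u

variable {Ω : Type u} [Field Ω] (V : ValuationSubring Ω) (K : Subfield Ω)

/-! ### Good approximants are strictly closer than the Taylor scale -/

/-- If `f(x)` approximates `y` at least as well as every element of `K` (`|y − f(x)| ≤ |y − b|`
for all `b ∈ K`; "`v(y − f(x)) ≥ dist(y, K)`"), `(K(y)|K)` has no closest element to `y`
(`y ∉ K`, immediate: `exists_valuation_sub_lt`), and `|f(x) − f(c)| = β|x − c|^k` strictly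
decreases as `c ↗ x`, then `|y − f(x)| < |f(x) − f(c)|` and `|y − f(c)| = |f(x) − f(c)|` for all
`c ∈ K` close to `x` (Kuhlmann–Vlahu 2014, Lemma 5.x (v>Λ) with Lemma 8.1:
"`v(y − f(x)) ≥ dist(y,K) = dist(f(x),K) > v(f(x) − f(c))`"). [cite: KuhlmannVlahu2014, Lemma 8.1] -/
theorem valuation_sub_eval_lt_of_good {x y : Ω} (hxK : x ∉ K)
    (hval : ∀ w ∈ Subfield.closure ((K : Set Ω) ∪ {x}), w ≠ 0 → ∃ b ∈ K,
      V.valuation w = V.valuation b)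
    (hres : ∀ w ∈ Subfield.closure ((K : Set Ω) ∪ {x}), w ∈ V → ∃ c ∈ K,
      V.valuation (w - c) < 1)
    (hyK : y ∉ K)
    (hvaly : ∀ w ∈ Subfield.closure ((K : Set Ω) ∪ {y}), w ≠ 0 → ∃ b ∈ K,
      V.valuation w = V.valuation b)
    (hresy : ∀ w ∈ Subfield.closure ((K : Set Ω) ∪ {y}), w ∈ V → ∃ c ∈ K,
      V.valuation (w - c) < 1)
    {f : Polynomial Ω} (hf : ∀ k, f.coeff k ∈ K)
    (hgood : ∀ b ∈ K, V.valuation (y - f.eval x) ≤ V.valuation (y - b))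
    {β : V.ValueGroup} (hβ : β ≠ 0) {k : ℕ} (hk : k ≠ 0) {a₀ : Ω}
    (hfk : ∀ c ∈ K, V.valuation (x - c) ≤ V.valuation (x - a₀) →
      V.valuation (f.eval x - f.eval c) = β * V.valuation (x - c) ^ k)
    {c : Ω} (hc : c ∈ K) (hle : V.valuation (x - c) ≤ V.valuation (x - a₀)) :
    V.valuation (y - f.eval x) < V.valuation (f.eval x - f.eval c) ∧
      V.valuation (y - f.eval c) = V.valuation (f.eval x - f.eval c) := by
  have hlt : V.valuation (y - f.eval x) < V.valuation (f.eval x - f.eval c) := by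
    by_contra hge
    push Not at hge
    -- one step closer: `|f(x) - f(c₁)| < |f(x) - f(c)| ≤ |y - f(x)|`, so `|y - f(c₁)| = |y - f(x)|`
    obtain ⟨c₁, hc₁K, hc₁⟩ := exists_valuation_sub_lt V K hxK hval hres hc
    have h1 : V.valuation (f.eval x - f.eval c₁) < V.valuation (y - f.eval x) := by
      refine lt_of_lt_of_le ?_ hge
      rw [hfk c hc hle, hfk c₁ hc₁K (hc₁.le.trans hle)]
      exact mul_lt_mul_of_pos_left (pow_lt_pow_left₀ hc₁ zero_le hk) (zero_lt_iff.mpr hβ)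
    have h2 : V.valuation (y - f.eval c₁) = V.valuation (y - f.eval x) := by
      have hid : y - f.eval c₁ = (y - f.eval x) + (f.eval x - f.eval c₁) := by ring
      rw [hid, Valuation.map_add_eq_of_lt_left _ h1]
    -- but `K` has elements closer to `y` than `f(c₁) ∈ K`
    have hfc₁K : f.eval c₁ ∈ K := eval_mem_subfield_of_coeff_mem hf hc₁K
    obtain ⟨b, hbK, hb⟩ := exists_valuation_sub_lt V K hyK hvaly hresy hfc₁K
    have := hgood b hbK
    rw [← h2] at this
    exact absurd hb (not_lt.mpr this)
  refine ⟨hlt, ?_⟩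
  have hid : y - f.eval c = (f.eval x - f.eval c) + (y - f.eval x) := by ring
  rw [hid, Valuation.map_add_eq_of_lt_left _ hlt]

/-! ### Kuhlmann–Vlahu 2014, Lemma 12.2 (𝐡 = 1): existence of approximation coefficients -/

/-- **Closer elements in an immediate `K(x)`**: for `w ∈ K(x)^×` there is `d ∈ K` with
`|w − d| < |w|` (take `b ∈ K` with `|b| = |w|` and `d₀ ∈ K` with the residue of `w/b`; `d = b d₀`).
[folklore] -/
theorem exists_mem_valuation_sub_lt_self {x : Ω}
    (hval : ∀ w ∈ Subfield.closure ((K : Set Ω) ∪ {x}), w ≠ 0 → ∃ b ∈ K,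
      V.valuation w = V.valuation b)
    (hres : ∀ w ∈ Subfield.closure ((K : Set Ω) ∪ {x}), w ∈ V → ∃ c ∈ K,
      V.valuation (w - c) < 1)
    {w : Ω} (hw : w ∈ Subfield.closure ((K : Set Ω) ∪ {x})) (hw0 : w ≠ 0) :
    ∃ d ∈ K, d ≠ 0 ∧ V.valuation d = V.valuation w ∧ V.valuation (w - d) < V.valuation w := by
  set E := Subfield.closure ((K : Set Ω) ∪ {x}) with hE
  have hKE : K ≤ E := fun c hc => Subfield.subset_closure (Or.inl hc)
  obtain ⟨b, hbK, hvb⟩ := hval w hw hw0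
  have hb0 : b ≠ 0 := by
    rintro rfl
    rw [map_zero, map_eq_zero] at hvb
    exact hw0 hvb
  have hvb0 : V.valuation b ≠ 0 := (_root_.map_ne_zero _).mpr hb0
  have huV : w / b ∈ V := by
    rw [← V.valuation_le_one_iff, map_div₀, ← hvb, div_self ((_root_.map_ne_zero _).mpr hw0)]
  obtain ⟨d₀, hd₀K, hd₀⟩ := hres (w / b) (div_mem hw (hKE hbK)) huV
  refine ⟨b * d₀, K.mul_mem hbK hd₀K, ?_, ?_, ?_⟩
  · intro h0
    rcases mul_eq_zero.mp h0 with h | h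
    · exact hb0 h
    · rw [h, sub_zero, map_div₀, ← hvb, div_self ((_root_.map_ne_zero _).mpr hw0)] at hd₀
      exact lt_irrefl _ hd₀
  · -- `|d₀| = 1`
    have hvd₀ : V.valuation d₀ = 1 := by
      have hu1 : V.valuation (w / b) = 1 := by
        rw [map_div₀, ← hvb, div_self ((_root_.map_ne_zero _).mpr hw0)]
      have hid : d₀ = w / b - (w / b - d₀) := by ring
      rw [hid, Valuation.map_sub_eq_of_lt_left _ (by rw [hu1]; exact hd₀), hu1]
    rw [map_mul, hvd₀, mul_one, hvb]
  · have hid : w - b * d₀ = b * (w / b - d₀) := by field_simp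
    rw [hid, map_mul, hvb]
    calc V.valuation b * V.valuation (w / b - d₀) < V.valuation b * 1 :=
          mul_lt_mul_of_pos_left hd₀ (zero_lt_iff.mpr hvb0)
      _ = V.valuation b := mul_one _

/-- **Kuhlmann–Vlahu 2014, Lemma 12.2 in relative approximation degree `1`: an approximation
coefficient exists.** For `f` over `K` with `|f₁(c)| = β ≠ 0` for `c ∈ K` close to `x`
(`f₁ = hasseDeriv 1 f`), there is `d ∈ K` with `|d| = β` and `|f₁(c) − d| < β` for all `c ∈ K`
close to `x` ("`vd = v f_𝐡(c) < v(f_𝐡(c) − d)` for `c ↗ x`"; proof: `d ∈ K` closer to `f₁(x)`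
than `|f₁(x)|`, immediateness, and the eventual constancy of `|f₁(c) − d|`).
[cite: KuhlmannVlahu2014, Lemma 12.2] -/
theorem exists_approximationCoefficient {x : Ω} (hxK : x ∉ K)
    (hval : ∀ w ∈ Subfield.closure ((K : Set Ω) ∪ {x}), w ≠ 0 → ∃ b ∈ K,
      V.valuation w = V.valuation b)
    (hres : ∀ w ∈ Subfield.closure ((K : Set Ω) ∪ {x}), w ∈ V → ∃ c ∈ K,
      V.valuation (w - c) < 1)
    (h3 : ∀ g : Polynomial Ω, (∀ k, g.coeff k ∈ K) → ∃ a₀ ∈ K, ∃ α : V.ValueGroup,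
      ∀ a ∈ K, V.valuation (x - a) ≤ V.valuation (x - a₀) → V.valuation (g.eval a) = α)
    {f : Polynomial Ω} (hf : ∀ k, f.coeff k ∈ K) {β : V.ValueGroup} (hβ : β ≠ 0)
    {a₀ : Ω} (ha₀K : a₀ ∈ K)
    (hβc : ∀ c ∈ K, V.valuation (x - c) ≤ V.valuation (x - a₀) →
      V.valuation ((hasseDeriv 1 f).eval c) = β) :
    ∃ d ∈ K, V.valuation d = β ∧ ∃ a₁ ∈ K, ∀ c ∈ K, V.valuation (x - c) ≤ V.valuation (x - a₁) →
      V.valuation ((hasseDeriv 1 f).eval c - d) < β := by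
  classical
  set f₁ := hasseDeriv 1 f with hf₁
  have hf₁K : ∀ k, f₁.coeff k ∈ K := coeff_hasseDeriv_mem K hf 1
  have hzE : x ∈ Subfield.closure ((K : Set Ω) ∪ {x}) := Subfield.subset_closure (Or.inr rfl)
  have hKE : K ≤ Subfield.closure ((K : Set Ω) ∪ {x}) := fun c hc => Subfield.subset_closure (Or.inl hc)
  -- `|f₁(x)| = β`
  obtain ⟨a₂, ha₂K, h₂⟩ := valuation_eval_eq_of_kaplansky V K hxK hval hres h3 hf₁K
  obtain ⟨a₃, ha₃K, ha₃⟩ : ∃ a₃ ∈ K, V.valuation (x - a₃) ≤ V.valuation (x - a₀) ∧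
      V.valuation (x - a₃) ≤ V.valuation (x - a₂) := by
    rcases le_total (V.valuation (x - a₀)) (V.valuation (x - a₂)) with h | h
    · exact ⟨a₀, ha₀K, le_rfl, h⟩
    · exact ⟨a₂, ha₂K, h, le_rfl⟩
  have hvf₁x : V.valuation (f₁.eval x) = β := by
    rw [← (h₂ a₃ ha₃K ha₃.2).1, hβc a₃ ha₃K ha₃.1]
  have hf₁x0 : f₁.eval x ≠ 0 := fun h0 => hβ (by rw [← hvf₁x, h0, map_zero])
  have hf₁xE : f₁.eval x ∈ Subfield.closure ((K : Set Ω) ∪ {x}) :=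
    eval_mem_subfield_of_coeff_mem (fun k => hKE (hf₁K k)) hzE
  -- `d ∈ K` closer to `f₁(x)` than `|f₁(x)|`
  obtain ⟨d, hdK, -, hvd, hd⟩ := exists_mem_valuation_sub_lt_self V K hval hres hf₁xE hf₁x0
  rw [hvf₁x] at hvd hd
  refine ⟨d, hdK, hvd, ?_⟩
  -- `|f₁(c) - d| = |f₁(x) - d| < β` near `x`
  set g : Polynomial Ω := f₁ - C d with hg
  have hgK : ∀ k, g.coeff k ∈ K := fun k => by
    rw [hg, coeff_sub, coeff_C]
    split_ifs
    · exact sub_mem (hf₁K k) hdK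
    · rw [sub_zero]; exact hf₁K k
  obtain ⟨a₁, ha₁K, h₁⟩ := valuation_eval_eq_of_kaplansky V K hxK hval hres h3 hgK
  refine ⟨a₁, ha₁K, fun c hc hle => ?_⟩
  have := (h₁ c hc hle).1
  rw [hg, eval_sub, eval_C, eval_sub, eval_C] at this
  rw [this]
  exact hd

/-! ### Kuhlmann–Vlahu 2014, Lemma 12.3 (𝐡 = 1): linear combinations without cancellation -/

/-- **Kuhlmann–Vlahu 2014, Lemma 12.3 in relative approximation degree `1`, polynomial part.**
For polynomials `f i` over `K` (`i ∈ s`, a finite set), each of relative approximation degree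
`1` at `x` — `|f i (x) − f i (c)| = βᵢ |x − c|` with `|(f i)₁(c)| = βᵢ` and the linear Taylor term
strictly dominating, for `c` close to `x` — with approximation coefficients `dᵢ ∈ K`
(`|dᵢ| = βᵢ`, `|(f i)₁(c) − dᵢ| < βᵢ`), and scalars `kᵢ ∈ K` WITHOUT CANCELLATION:
`|∑ kᵢ dᵢ| = maxᵢ |kᵢ dᵢ| ≠ 0` (rendered: `|kᵢ dᵢ| ≤ |∑ kᵢ dᵢ|` for all `i`, and `∑ kᵢ dᵢ ≠ 0`).
Then `g = ∑ kᵢ · f i` has relative approximation degree `1` at `x` with constant `|∑ kᵢ dᵢ|`: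
`|g(x) − g(c)| = |∑ kᵢ dᵢ| · |x − c|` and `|g₁(c)| = |∑ kᵢ dᵢ|` for `c` close to `x`. PROVED along
the printed computation (`v g₁(c) = v ∑ kᵢ dᵢ`; the higher Taylor terms of `g` are sums of
dominated terms). [cite: KuhlmannVlahu2014, Lemma 12.3] -/
theorem approximationDegree_one_sum {ι : Type*} (s : Finset ι) {x : Ω} (hxK : x ∉ K)
    (f : ι → Polynomial Ω) (β : ι → V.ValueGroup)
    (d kk : ι → Ω) (hd : ∀ i ∈ s, d i ∈ K ∧ V.valuation (d i) = β i)
    {a₀ : Ω}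
    (hdom : ∀ i ∈ s, ∀ c ∈ K, V.valuation (x - c) ≤ V.valuation (x - a₀) →
      V.valuation ((hasseDeriv 1 (f i)).eval c - d i) < β i ∧
      ∀ j, 2 ≤ j → V.valuation ((hasseDeriv j (f i)).eval c * (x - c) ^ j) <
        β i * V.valuation (x - c))
    (hmax : ∀ i ∈ s, V.valuation (kk i * d i) ≤ V.valuation (∑ i ∈ s, kk i * d i))
    (hne : ∑ i ∈ s, kk i * d i ≠ 0) :
    ∀ c ∈ K, V.valuation (x - c) ≤ V.valuation (x - a₀) →
      V.valuation ((hasseDeriv 1 (∑ i ∈ s, C (kk i) * f i)).eval c) =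
          V.valuation (∑ i ∈ s, kk i * d i) ∧
      (∀ j, 2 ≤ j → V.valuation ((hasseDeriv j (∑ i ∈ s, C (kk i) * f i)).eval c * (x - c) ^ j) <
          V.valuation (∑ i ∈ s, kk i * d i) * V.valuation (x - c)) ∧
      V.valuation ((∑ i ∈ s, C (kk i) * f i).eval x - (∑ i ∈ s, C (kk i) * f i).eval c) =
          V.valuation (∑ i ∈ s, kk i * d i) * V.valuation (x - c) := by
  classical
  intro c hc hle
  set g : Polynomial Ω := ∑ i ∈ s, C (kk i) * f i with hg
  set D : Ω := ∑ i ∈ s, kk i * d i with hD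
  have hvD0 : V.valuation D ≠ 0 := (_root_.map_ne_zero _).mpr hne
  have hxc0 : V.valuation (x - c) ≠ 0 := (_root_.map_ne_zero _).mpr fun h0 =>
    hxK (by rw [sub_eq_zero.mp h0]; exact hc)
  -- Hasse derivatives of `g`
  have hhasse : ∀ j, hasseDeriv j g = ∑ i ∈ s, C (kk i) * hasseDeriv j (f i) := by
    intro j
    rw [hg, map_sum]
    refine Finset.sum_congr rfl fun i _ => ?_
    rw [← smul_eq_C_mul, ← smul_eq_C_mul, LinearMap.map_smul]
  -- (1) the linear coefficient: `g₁(c) = D + ∑ kᵢ ((f i)₁(c) - dᵢ)`, the sum being `< |D|`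
  have h1 : V.valuation ((hasseDeriv 1 g).eval c) = V.valuation D := by
    have hid : (hasseDeriv 1 g).eval c = D + ∑ i ∈ s, kk i * ((hasseDeriv 1 (f i)).eval c - d i) := by
      rw [hhasse, eval_finsetSum, hD, ← Finset.sum_add_distrib]
      refine Finset.sum_congr rfl fun i _ => ?_
      rw [eval_mul, eval_C]; ring
    rw [hid, Valuation.map_add_eq_of_lt_left]
    by_cases hs : s.Nonempty
    · refine Valuation.map_sum_lt _ hvD0 fun i hi => ?_
      rw [map_mul]
      by_cases hki : kk i = 0
      · rw [hki, map_zero, zero_mul]; exact zero_lt_iff.mpr hvD0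
      · have hvki : 0 < V.valuation (kk i) := (Valuation.pos_iff _).mpr hki
        calc V.valuation (kk i) * V.valuation ((hasseDeriv 1 (f i)).eval c - d i)
            < V.valuation (kk i) * β i := mul_lt_mul_of_pos_left (hdom i hi c hc hle).1 hvki
          _ = V.valuation (kk i * d i) := by rw [map_mul, (hd i hi).2]
          _ ≤ V.valuation D := hmax i hi
    · rw [Finset.not_nonempty_iff_eq_empty.mp hs, Finset.sum_empty, map_zero]
      exact zero_lt_iff.mpr hvD0
  -- (2) the higher terms
  have h2 : ∀ j, 2 ≤ j → V.valuation ((hasseDeriv j g).eval c * (x - c) ^ j) <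
      V.valuation D * V.valuation (x - c) := by
    intro j hj
    rw [hhasse, eval_finsetSum, Finset.sum_mul]
    refine Valuation.map_sum_lt _ (mul_ne_zero hvD0 hxc0) fun i hi => ?_
    rw [eval_mul, eval_C, mul_assoc, map_mul]
    by_cases hki : kk i = 0
    · rw [hki, map_zero, zero_mul]
      exact mul_pos (zero_lt_iff.mpr hvD0) (zero_lt_iff.mpr hxc0)
    · have hvki : 0 < V.valuation (kk i) := (Valuation.pos_iff _).mpr hki
      calc V.valuation (kk i) * V.valuation ((hasseDeriv j (f i)).eval c * (x - c) ^ j)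
          < V.valuation (kk i) * (β i * V.valuation (x - c)) :=
            mul_lt_mul_of_pos_left ((hdom i hi c hc hle).2 j hj) hvki
        _ = V.valuation (kk i * d i) * V.valuation (x - c) := by rw [map_mul, (hd i hi).2, mul_assoc]
        _ ≤ V.valuation D * V.valuation (x - c) := mul_le_mul' (hmax i hi) le_rfl
  refine ⟨h1, h2, ?_⟩
  -- (3) Taylor expansion of `g` at `c` (`deg g ≥ 1` since `g₁(c) ≠ 0`)
  set N := g.natDegree with hN
  have hN1 : 1 ≤ N := by
    by_contra h0
    push Not at h0
    have h00 : hasseDeriv 1 g = 0 := hasseDeriv_eq_zero_of_lt_natDegree _ _ (by omega)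
    rw [h00, eval_zero, map_zero] at h1
    exact hvD0 h1.symm
  have htaylor : g.eval x - g.eval c =
      (hasseDeriv 1 g).eval c * (x - c) +
        ∑ j ∈ Finset.Ico 2 (N + 1), (hasseDeriv j g).eval c * (x - c) ^ j := by
    have h1' : g.eval x = (taylor c g).eval (x - c) := by rw [taylor_eval, sub_add_cancel]
    have hdegT : (taylor c g).natDegree < N + 1 := by
      rw [natDegree_taylor]; exact Nat.lt_succ_self _
    rw [h1', eval_eq_sum_range' hdegT, Finset.range_eq_Ico,
      Finset.sum_eq_sum_Ico_succ_bot (Nat.succ_pos N),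
      Finset.sum_eq_sum_Ico_succ_bot (by omega : 1 < N + 1)]
    simp only [taylor_coeff, hasseDeriv_zero, LinearMap.id_apply, pow_zero, mul_one, pow_one]
    ring
  rw [htaylor, Valuation.map_add_eq_of_lt_left]
  · rw [map_mul, h1]
  · rw [map_mul, h1]
    refine Valuation.map_sum_lt _ (mul_ne_zero hvD0 hxc0) fun j hj => ?_
    exact h2 j (Finset.mem_Ico.mp hj).1

end Literature.AlgebraicGeometry.Resolution
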